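import Summits.MatrixMultiplication.OmegaCensus.DominoZ11StructSevenData
import Summits.MatrixMultiplication.OmegaCensus.DominoZpZpStructSevenCheck
import HarnessLib

/-!
# The pair checks of family `B` for the structural part-`7` route, `p = 11` (part 9 of 18: group 3, blocks 15–19)

ω-census `pub-omega`, family (b3), seat pub-omega-group gen 24.  Framing: lottery ticket; floor = certified bounds/negative
ranges.  VALUE: per-prime kernel data of the STRUCTURAL part-`7` route (`DominoZpZpStructSeven*.lean`) for `p = 11` —
target: the OPEN census cells `(1,7,23)@484` ×2 (`A = ℤ₄ × ℤ₁₁²`, `ℤ₂² × ℤ₁₁²`) and every larger order; NOT progress on ω.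

BATCHED kernel decides `checkH7bxs 11 etZ11s7 ((rZ11s7.drop 4c).take 4) xsbZ11s7_g3` (`DominoZpZpStructSevenCheck.lean`): the
`y`-arrangements of the 4 representatives of block `c` are generated once in the kernel and tested against every `x`-arrangement
of the group (≈ 7.4 ms per configuration measured on the farm; 18880 configurations in this file; one decide ≲ 35 s keeps the
kernel under its memory ceiling).  Per-arrangement / per-representative theorems: `DominoZ11StructSevenPairsBX*.lean`.
Exact pre-check (`code/gen_struct7c.py`, same programs in Python): all 417360 configurations of family `B`
have ≥ 8 good pairs of the 21.  Independent of the other parts.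
-/

namespace Summit.MatrixMultiplication.OmegaCensus

open ZpZpDomino

namespace ZpZpDomino

set_option maxHeartbeats 4000000 in
/-- Batched pair check, family `B`, group 3, `y`-source block 15 (8 × 480 configurations). [folklore] -/
theorem checkH7bxs_11_g3_c15 : checkH7bxs 11 etZ11s7 ((rZ11s7.drop 56).take 4) xsbZ11s7_g3 = true := by
  decide +kernel

set_option maxHeartbeats 4000000 in
/-- Batched pair check, family `B`, group 3, `y`-source block 16 (8 × 480 configurations). [folklore] -/
theorem checkH7bxs_11_g3_c16 : checkH7bxs 11 etZ11s7 ((rZ11s7.drop 60).take 4) xsbZ11s7_g3 = true := by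
  decide +kernel

set_option maxHeartbeats 4000000 in
/-- Batched pair check, family `B`, group 3, `y`-source block 17 (8 × 480 configurations). [folklore] -/
theorem checkH7bxs_11_g3_c17 : checkH7bxs 11 etZ11s7 ((rZ11s7.drop 64).take 4) xsbZ11s7_g3 = true := by
  decide +kernel

set_option maxHeartbeats 4000000 in
/-- Batched pair check, family `B`, group 3, `y`-source block 18 (8 × 440 configurations). [folklore] -/
theorem checkH7bxs_11_g3_c18 : checkH7bxs 11 etZ11s7 ((rZ11s7.drop 68).take 4) xsbZ11s7_g3 = true := by
  decide +kernel

set_option maxHeartbeats 4000000 in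
/-- Batched pair check, family `B`, group 3, `y`-source block 19 (8 × 480 configurations). [folklore] -/
theorem checkH7bxs_11_g3_c19 : checkH7bxs 11 etZ11s7 ((rZ11s7.drop 72).take 4) xsbZ11s7_g3 = true := by
  decide +kernel

end ZpZpDomino

end Summit.MatrixMultiplication.OmegaCensus
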